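import Summits.ResolutionOfSingularities.ResolutionOfSingularities.Theorems.FrobeniusLadderFInjectiveMacaulayficationFermatCubicConeChar2
import Summits.ResolutionOfSingularities.ResolutionOfSingularities.Theorems.FrobeniusLadderFInjectiveMacaulayficationFedderViaSlicing
import Summits.ResolutionOfSingularities.ResolutionOfSingularities.Theorems.FrobeniusLadderFInjectiveMacaulayficationClauseOfPderivNotMem
import Summits.ResolutionOfSingularities.ResolutionOfSingularities.Theorems.FrobeniusLadderFInjectiveMacaulayficationHypersurfaceRegular
import Literature.AlgebraicGeometry.Motives.HypersurfaceFormsIrreducible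
import Mathlib.Algebra.MvPolynomial.Equiv
import Mathlib.Algebra.MvPolynomial.PDeriv
import Mathlib.Logic.Equiv.Fin.Basic
import HarnessLib

/-!
# The DOUBLE POINT over the Fermat cubic, `x₀² + x₁³ + ⋯ + x_{n−1}³ = 0 ⊂ 𝔸ⁿ` in characteristic 2: chart certificates of its ONE-POINT blow-up
# (crux `FInjectiveMacaulayfication` stmt-ResolutionOfSingularities-15315, chain w45a; res-L1-w45a-stub-1 g9 OFFER (C) «INFORMATIVE STRATUM germ
# instances»; FILE 3a = ring-level certificates; seat res-L1-w45a-stub-1 g9)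

[OURS · L1 W4.5a] Support file (`--supports stmt-ResolutionOfSingularities-15315 --as helper`); replaces the role of NO printed item; NOT a
statement of the manuscript; def-free, unconditional; a CERTIFICATE. AI-written (AI review is weaker than expert review).

## The specimen
`k` a field of characteristic `2`, `n = m + 4 ≥ 4`, `f = X₀² + Σ_{l < m+3} X_{l+1}³ ∈ k[X₀, …, X_{m+3}]` — an ISOLATED F-degenerate DOUBLE POINT
`z² = B` (`B` the Fermat cubic in `m + 3 ≥ 3` variables; `f ∈ 𝔪^{[2]}`), `d = dim = m + 3 ≥ 3`: res-L1-w45a-idea-1's DP4 class, in characteristic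
`2` instead of `3`. ONE point blow-up FULL-ifies it, and — unlike the Fermat cubic CONE (p599694, TRIVIAL STRATUM) — the FULL model is STILL
SINGULAR: the chart `X_{l+1}` carries the strict transform `g_{l+1} = X₀² + X_{l+1}·(1 + Σ_{j} X_{(l.succAbove j)+1}³)`, singular exactly along the
`(m+1)`-fold `{X₀ = X_{l+1} = 0, 1 + Σ X³ = 0}` inside the exceptional divisor, where it is F-PURE by Fedder's criterion read through a slicing
(`FedderViaSlicing.clause_of_sliceCoeff`: slices `X₀, X_{l+1}`, the `Y₁`-coefficient of `Ψ g` is `φ = 1 + Σ_j yⱼ³`, whose zero set is SMOOTH in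
characteristic 2). INFORMATIVE STRATUM «FULL model still singular» (res-L1-w45a-tri-2 #348 (c)).

## What is here (ring level; the scheme-level germ instance is FILE 3b `…DoublePointFermatCubicGerm`)
* §1 identities: `theta_zero` / `theta_succ` (`θ₀ f = X₀²·(1 + X₀ Σ X³)`, `θ_{l+1} f = X_{l+1}²·g_{l+1}`), `pderiv_zero_f`, `pderiv_succ_f` (`= X_{l+1}²`),
  `f_not_mem_span_X`, `g_zero_not_mem_span_X`, `g_succ_not_mem_span_X`, `prime_f` (Eisenstein on `T² + C(Σ y³)` at `(1,1,0,…)`).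
* §2 `regular_off_vertex` — `(k[X]/(f))_P` is regular at every prime `P ⊉ (x̄₀, …, x̄_{m+3})` (Jacobian: `∂_{l+1} f = X_{l+1}²`; if all `X_{l+1} ∈ P`
  then `X₀² = f − Σ ∈ P`).
* §3 `chart_zero_vacuous` — the chart `X₀` does not meet the exceptional divisor (`g₀ = 1 + X₀·Σ ≡ 1 mod X₀`).
* §4 `exists_slicing` (`k[X] ≃ k[y][Y₀,Y₁]`, `X₀ ↦ Y₀`, `X_{l+1} ↦ Y₁`, `X_{(l.succAbove j)+1} ↦ C yⱼ`) and ★ `chart_succ_clause` — the CM + Frobenius-closed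
  clause of `k[X]/(g_{l+1})` at EVERY maximal ideal containing `x̄_{l+1}`: Jacobian where `h = 1 + Σ X³ ∉ Q` (`∂_{l+1} g = h`), FEDDER-VIA-SLICING where
  `h ∈ Q` (singular points).

[folklore mathematics, OURS as a certificate; cite: Fedder1983, Prop. 1.7 and Thm. 1.12; Hartshorne1977, I Thm. 5.1; Kollar2007, §2.5 (strict
transforms under point blow-ups)]
-/

-- single-problem summit: the doubled namespace component is forced
set_option linter.dupNamespace false

noncomputable section

open MvPolynomial

namespace Summit.ResolutionOfSingularities.ResolutionOfSingularities.Theorems.FInjectiveMacaulayfication.DoublePointFermatCubicCharts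

open Summit.ResolutionOfSingularities.ResolutionOfSingularities.Theorems.FInjectiveMacaulayfication
open Summit.ResolutionOfSingularities.ResolutionOfSingularities.Theorems.FInjectiveMacaulayfication.WildPinchClosedCentre

/-! ## §1 Polynomial identities -/

/-- In characteristic `2`: `(2 : k[X]) = 0`, `(3 : k[X]) = 1` (lead-1's `FermatCubicConeChar2.two_three`, re-exported for `n = m + 4`). [plumbing] -/
theorem two_three' (k : Type) [Field k] [CharP k 2] (m : ℕ) :
    (2 : MvPolynomial (Fin (m + 4)) k) = 0 ∧ (3 : MvPolynomial (Fin (m + 4)) k) = 1 :=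
  FermatCubicConeChar2.two_three k (n := m + 4)

/-- **Chart `X₀`: `θ₀ f = X₀² · (1 + X₀ · Σ X_{l+1}³)`.** [folklore] -/
theorem theta_zero (k : Type) [Field k] (m : ℕ) (f : MvPolynomial (Fin (m + 4)) k)
    (hf : f = X 0 ^ 2 + ∑ l : Fin (m + 3), X l.succ ^ 3) :
    aeval (fun j : Fin (m + 4) => if j = 0 then (X 0 : MvPolynomial (Fin (m + 4)) k) else X j * X 0) f =
      X 0 ^ 2 * (1 + X 0 * ∑ l : Fin (m + 3), (X l.succ : MvPolynomial (Fin (m + 4)) k) ^ 3) := by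
  rw [hf, map_add, map_pow, aeval_X, if_pos rfl, map_sum]
  have h : ∀ l : Fin (m + 3), aeval (fun j : Fin (m + 4) => if j = 0 then (X 0 : MvPolynomial (Fin (m + 4)) k) else X j * X 0)
      ((X l.succ : MvPolynomial (Fin (m + 4)) k) ^ 3) = X l.succ ^ 3 * X 0 ^ 3 := fun l => by
    rw [map_pow, aeval_X, if_neg (Fin.succ_ne_zero l)]
    ring
  rw [Finset.sum_congr rfl fun l _ => h l, ← Finset.sum_mul]
  ring

/-- **Chart `X_{l+1}`: `θ_{l+1} f = X_{l+1}² · (X₀² + X_{l+1} · (1 + Σ_j X_{(l.succAbove j)+1}³))`.** [folklore] -/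
theorem theta_succ (k : Type) [Field k] (m : ℕ) (f : MvPolynomial (Fin (m + 4)) k)
    (hf : f = X 0 ^ 2 + ∑ l : Fin (m + 3), X l.succ ^ 3) (l : Fin (m + 3)) :
    aeval (fun j : Fin (m + 4) => if j = l.succ then (X l.succ : MvPolynomial (Fin (m + 4)) k) else X j * X l.succ) f =
      X l.succ ^ 2 * (X 0 ^ 2 + X l.succ * (1 + ∑ j : Fin (m + 2), (X (l.succAbove j).succ : MvPolynomial (Fin (m + 4)) k) ^ 3)) := by
  rw [hf, map_add, map_pow, aeval_X, if_neg (Fin.succ_ne_zero l).symm, map_sum, Fin.sum_univ_succAbove _ l, map_pow, aeval_X,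
    if_pos rfl]
  have h : ∀ j : Fin (m + 2), aeval (fun j : Fin (m + 4) => if j = l.succ then (X l.succ : MvPolynomial (Fin (m + 4)) k) else X j * X l.succ)
      ((X (l.succAbove j).succ : MvPolynomial (Fin (m + 4)) k) ^ 3) = X (l.succAbove j).succ ^ 3 * X l.succ ^ 3 := fun j => by
    rw [map_pow, aeval_X, if_neg (fun h => Fin.succAbove_ne l j (Fin.succ_injective _ h))]
    ring
  rw [Finset.sum_congr rfl fun j _ => h j, ← Finset.sum_mul]
  ring

/-- `∂f/∂X₀ = 2X₀` (`= 0` in characteristic 2; we only need its value `0` at the origin). [folklore] -/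
theorem pderiv_zero_f (k : Type) [Field k] (m : ℕ) (f : MvPolynomial (Fin (m + 4)) k)
    (hf : f = X 0 ^ 2 + ∑ l : Fin (m + 3), X l.succ ^ 3) : pderiv 0 f = 2 * X 0 := by
  rw [hf, map_add, pderiv_pow, pderiv_X_self, map_sum,
    Finset.sum_eq_zero fun l _ => by rw [pderiv_pow, pderiv_X_of_ne (Fin.succ_ne_zero l), mul_zero]]
  push_cast
  ring

/-- `∂f/∂X_{l+1} = 3X_{l+1}²` (`= X_{l+1}²` in characteristic 2). [folklore] -/
theorem pderiv_succ_f (k : Type) [Field k] (m : ℕ) (f : MvPolynomial (Fin (m + 4)) k)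
    (hf : f = X 0 ^ 2 + ∑ l : Fin (m + 3), X l.succ ^ 3) (l : Fin (m + 3)) : pderiv l.succ f = 3 * X l.succ ^ 2 := by
  rw [hf, map_add, pderiv_pow, pderiv_X_of_ne (Fin.succ_ne_zero l).symm, mul_zero, zero_add, map_sum,
    Finset.sum_eq_single l (fun l' _ hl' => by
      rw [pderiv_pow, pderiv_X_of_ne (fun h => hl' (Fin.succ_injective _ h)), mul_zero])
    (fun h => absurd (Finset.mem_univ l) h), pderiv_pow, pderiv_X_self, mul_one]
  push_cast
  ring

/-- `∂/∂X_{l+1}` of the chart cofactor: `∂(1 + Σ_j X_{(l.succAbove j)+1}³)/∂X_{l+1} = 0` (the variable `X_{l+1}` does not occur). [folklore] -/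
theorem pderiv_succ_h (k : Type) [Field k] (m : ℕ) (l : Fin (m + 3)) :
    pderiv l.succ (1 + ∑ j : Fin (m + 2), (X (l.succAbove j).succ : MvPolynomial (Fin (m + 4)) k) ^ 3) = 0 := by
  rw [map_add, pderiv_one, zero_add, map_sum]
  exact Finset.sum_eq_zero fun j _ => by
    rw [pderiv_pow, pderiv_X_of_ne (fun h => Fin.succAbove_ne l j (Fin.succ_injective _ h)), mul_zero]

/-- `∂g_{l+1}/∂X_{l+1} = h` for `g_{l+1} = X₀² + X_{l+1}·h`, `h = 1 + Σ_j X_{(l.succAbove j)+1}³`. [folklore] -/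
theorem pderiv_succ_g (k : Type) [Field k] (m : ℕ) (l : Fin (m + 3)) (h : MvPolynomial (Fin (m + 4)) k)
    (hh : h = 1 + ∑ j : Fin (m + 2), (X (l.succAbove j).succ : MvPolynomial (Fin (m + 4)) k) ^ 3) :
    pderiv l.succ (X 0 ^ 2 + X l.succ * h) = h := by
  have h0 : pderiv l.succ h = 0 := by rw [hh]; exact pderiv_succ_h k m l
  rw [map_add, pderiv_pow, pderiv_X_of_ne (Fin.succ_ne_zero l).symm, mul_zero, zero_add, Derivation.leibniz, h0, smul_zero,
    zero_add, pderiv_X_self, smul_eq_mul, mul_one]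

/-- `f ∉ (Xᵢ)` for every `i`: `f` takes the value `1` at a coordinate point `e_{l+1}` with `l + 1 ≠ i`. [folklore] -/
theorem f_not_mem_span_X (k : Type) [Field k] (m : ℕ) (f : MvPolynomial (Fin (m + 4)) k)
    (hf : f = X 0 ^ 2 + ∑ l : Fin (m + 3), X l.succ ^ 3) (i : Fin (m + 4)) :
    f ∉ Ideal.span {(X i : MvPolynomial (Fin (m + 4)) k)} := by
  rw [Ideal.mem_span_singleton]
  -- a cube variable `X_{l₀+1}` different from `Xᵢ`
  obtain ⟨l₀, hl₀⟩ : ∃ l₀ : Fin (m + 3), l₀.succ ≠ i := by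
    by_cases hi : i = (0 : Fin (m + 3)).succ
    · exact ⟨1, by rw [hi]; exact fun h => absurd (Fin.succ_injective _ h) one_ne_zero⟩
    · exact ⟨0, fun h => hi h.symm⟩
  refine not_X_dvd_of_eval (Pi.single l₀.succ 1) i (Pi.single_eq_of_ne (Ne.symm hl₀) _) f ?_
  rw [hf, map_add, map_pow, eval_X, Pi.single_eq_of_ne (Fin.succ_ne_zero l₀).symm, zero_pow two_ne_zero, zero_add, map_sum,
    Finset.sum_eq_single l₀ (fun l _ hl => by
      rw [map_pow, eval_X, Pi.single_eq_of_ne (fun h => hl (Fin.succ_injective _ h)), zero_pow three_ne_zero])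
    (fun h => absurd (Finset.mem_univ l₀) h), map_pow, eval_X, Pi.single_eq_same, one_pow]
  exact one_ne_zero

/-- `g₀ = 1 + X₀·Σ ∉ (X₀)`: `g₀(0) = 1`. [folklore] -/
theorem g_zero_not_mem_span_X (k : Type) [Field k] (m : ℕ) :
    (1 + X 0 * ∑ l : Fin (m + 3), (X l.succ : MvPolynomial (Fin (m + 4)) k) ^ 3) ∉
      Ideal.span {(X 0 : MvPolynomial (Fin (m + 4)) k)} := by
  rw [Ideal.mem_span_singleton]
  refine not_X_dvd_of_eval (fun _ => 0) 0 rfl _ ?_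
  simp

/-- `g_{l+1} = X₀² + X_{l+1}·h ∉ (X_{l+1})`: `g_{l+1}(e₀) = 1`. [folklore] -/
theorem g_succ_not_mem_span_X (k : Type) [Field k] (m : ℕ) (l : Fin (m + 3)) :
    (X 0 ^ 2 + X l.succ * (1 + ∑ j : Fin (m + 2), (X (l.succAbove j).succ : MvPolynomial (Fin (m + 4)) k) ^ 3)) ∉
      Ideal.span {(X l.succ : MvPolynomial (Fin (m + 4)) k)} := by
  rw [Ideal.mem_span_singleton]
  refine not_X_dvd_of_eval (Pi.single 0 1) l.succ (Pi.single_eq_of_ne (Fin.succ_ne_zero l) _) _ ?_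
  rw [map_add, map_pow, eval_X, Pi.single_eq_same, one_pow, map_mul, eval_X, Pi.single_eq_of_ne (Fin.succ_ne_zero l), zero_mul,
    add_zero]
  exact one_ne_zero

/-- **`f = X₀² + Σ X_{l+1}³` is PRIME in characteristic 2**: `k[X₀, …] ≃ k[y][T]` (`X₀ ↦ T`), `f ↦ T² + C c`, `c = Σ yₗ³` the Fermat cubic in
`m + 3 ≥ 3` variables; Eisenstein at the point `(1, 1, 0, …, 0)` of `c = 0` where `∂c/∂y₀ = 3 = 1 ≠ 0`. [folklore] -/
theorem prime_f (k : Type) [Field k] [CharP k 2] (m : ℕ) (f : MvPolynomial (Fin (m + 4)) k)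
    (hf : f = X 0 ^ 2 + ∑ l : Fin (m + 3), X l.succ ^ 3) : Prime f := by
  set e : MvPolynomial (Fin (m + 4)) k ≃+* Polynomial (MvPolynomial (Fin (m + 3)) k) := (finSuccEquiv k (m + 3)).toRingEquiv
    with he_def
  have he0 : e (X 0) = Polynomial.X := finSuccEquiv_X_zero
  have hes : ∀ l : Fin (m + 3), e (X l.succ) = Polynomial.C (X l) := fun l => finSuccEquiv_X_succ (j := l)
  set c : MvPolynomial (Fin (m + 3)) k := ∑ l : Fin (m + 3), X l ^ 3 with hc
  have hef : e f = Polynomial.X ^ 2 + Polynomial.C c := by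
    rw [hf, map_add, map_pow, he0, map_sum, hc, map_sum]
    congr 1
    exact Finset.sum_congr rfl fun l _ => by rw [map_pow, hes, map_pow]
  -- the rational point `a = (1, 1, 0, …, 0)` of `c = 0`
  set a : Fin (m + 3) → k := Fin.cons 1 (Fin.cons 1 fun _ => 0) with ha
  have h2 : (2 : k) = 0 := by simpa using CharP.cast_eq_zero k 2
  have hcval : MvPolynomial.eval a c = 0 := by
    rw [hc, map_sum]
    simp only [map_pow, eval_X]
    rw [Fin.sum_univ_succ, Fin.sum_univ_succ]
    simp only [ha, Fin.cons_zero, Fin.cons_succ, one_pow, zero_pow three_ne_zero, Finset.sum_const_zero, add_zero]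
    rw [show (1 : k) + 1 = 2 by norm_num, h2]
  have hpd : pderiv 0 c = 3 * X 0 ^ 2 := FermatCubicConeChar2.pderiv_f k c hc 0
  have hder : MvPolynomial.eval a (pderiv 0 c) ≠ 0 := by
    rw [hpd]
    simp only [map_mul, map_pow, eval_X, ha, Fin.cons_zero, one_pow, mul_one]
    rw [show (MvPolynomial.eval (Fin.cons 1 (Fin.cons 1 fun _ => (0 : k)) : Fin (m + 3) → k)) 3 = (2 : k) + 1 by
      rw [map_ofNat]; norm_num, h2, zero_add]
    exact one_ne_zero
  have hirr : Irreducible (e f) := by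
    rw [hef]
    exact Literature.AlgebraicGeometry.Motives.SmoothHypersurface.irreducible_X_pow_add_C (d := 2) (by norm_num) c a hcval 0 hder
  exact (MulEquiv.prime_iff e).mp hirr.prime

/-! ## §2 Off the vertex the double point is regular -/

/-- **`(k[X]/(f))_P` is a regular local ring at every prime `P ⊉ (x̄₀, …, x̄_{m+3})`.** Some `x̄ᵢ ∉ P`; if a cube variable `X_{l+1} ∉ P` the
Jacobian criterion applies (`∂_{l+1} f = X_{l+1}²`); if all cube variables lie in `P` then so does `X₀² = f − Σ X_{l+1}³`, hence `X₀`, so `P ⊇ 𝔪`.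
[cite: Hartshorne1977, I Thm. 5.1] -/
theorem regular_off_vertex (k : Type) [Field k] [CharP k 2] (m : ℕ) (f : MvPolynomial (Fin (m + 4)) k)
    (hf : f = X 0 ^ 2 + ∑ l : Fin (m + 3), X l.succ ^ 3)
    (P : Ideal (MvPolynomial (Fin (m + 4)) k ⧸ Ideal.span {f})) [P.IsPrime]
    (hP : ¬ Ideal.span (Set.range fun j : Fin (m + 4) => Ideal.Quotient.mk (Ideal.span {f}) (X j)) ≤ P) :
    IsRegularLocalRing (Localization.AtPrime P) := by
  have h23 := two_three' k m
  have hP' : (P.comap (Ideal.Quotient.mk (Ideal.span {f}))).IsPrime := Ideal.comap_isPrime _ _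
  -- some cube variable misses `P`
  have hex : ∃ l : Fin (m + 3), (X l.succ : MvPolynomial (Fin (m + 4)) k) ∉ P.comap (Ideal.Quotient.mk (Ideal.span {f})) := by
    by_contra hall
    push Not at hall
    apply hP
    rw [Ideal.span_le]
    rintro _ ⟨j, rfl⟩
    refine Fin.cases ?_ (fun l => ?_) j
    · -- `X₀² = f − Σ X_{l+1}³ ∈ P`
      have hfP : f ∈ P.comap (Ideal.Quotient.mk (Ideal.span {f})) := FermatCubicConeChar2.self_mem_comap f P
      have hsum : (∑ l : Fin (m + 3), (X l.succ : MvPolynomial (Fin (m + 4)) k) ^ 3) ∈ P.comap (Ideal.Quotient.mk (Ideal.span {f})) :=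
        Ideal.sum_mem _ fun l _ => Ideal.pow_mem_of_mem _ (hall l) 3 (by norm_num)
      have hX0 : (X 0 : MvPolynomial (Fin (m + 4)) k) ^ 2 ∈ P.comap (Ideal.Quotient.mk (Ideal.span {f})) := by
        have e : (X 0 : MvPolynomial (Fin (m + 4)) k) ^ 2 = f - ∑ l : Fin (m + 3), X l.succ ^ 3 := by rw [hf]; ring
        rw [e]
        exact Ideal.sub_mem _ hfP hsum
      exact Ideal.mem_comap.mp (hP'.mem_of_pow_mem 2 hX0)
    · exact Ideal.mem_comap.mp (hall l)
  obtain ⟨l, hl⟩ := hex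
  exact HypersurfaceRegular.stub_hypersurfaceRegularOfPderiv k (m + 4) f l.succ P
    (by rw [pderiv_succ_f k m f hf l, h23.2, one_mul]; exact fun h => hl (hP'.mem_of_pow_mem 2 h))

/-! ## §3 The chart `X₀` misses the exceptional divisor -/

/-- **No maximal ideal of `k[X]/(g₀)`, `g₀ = 1 + X₀·Σ X_{l+1}³`, contains `x̄₀`** (`1 = g₀ − X₀·Σ` would lie in it). [folklore] -/
theorem chart_zero_vacuous (k : Type) [Field k] (m : ℕ)
    (Q : Ideal (MvPolynomial (Fin (m + 4)) k ⧸ Ideal.span {(1 + X 0 * ∑ l : Fin (m + 3), (X l.succ : MvPolynomial (Fin (m + 4)) k) ^ 3)}))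
    [Q.IsMaximal]
    (hQ : Ideal.Quotient.mk (Ideal.span {(1 + X 0 * ∑ l : Fin (m + 3), (X l.succ : MvPolynomial (Fin (m + 4)) k) ^ 3)}) (X 0) ∈ Q) :
    False := by
  have hP : (Q.comap (Ideal.Quotient.mk (Ideal.span
      {(1 + X 0 * ∑ l : Fin (m + 3), (X l.succ : MvPolynomial (Fin (m + 4)) k) ^ 3)}))).IsPrime := Ideal.comap_isPrime _ _
  have hg := FermatCubicConeChar2.self_mem_comap (1 + X 0 * ∑ l : Fin (m + 3), (X l.succ : MvPolynomial (Fin (m + 4)) k) ^ 3) Q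
  have hX0 : (X 0 : MvPolynomial (Fin (m + 4)) k) ∈ Q.comap (Ideal.Quotient.mk _) := hQ
  have h1 := Ideal.sub_mem _ hg (Ideal.mul_mem_right (∑ l : Fin (m + 3), (X l.succ : MvPolynomial (Fin (m + 4)) k) ^ 3) _ hX0)
  rw [add_sub_cancel_right] at h1
  exact hP.ne_top ((Ideal.eq_top_iff_one _).mpr h1)

/-! ## §4 The chart `X_{l+1}`: Jacobian off `h = 0`, FEDDER THROUGH A SLICING on `h = 0` -/

/-- **The slicing for the chart `X_{l+1}`**: `k[X₀, …, X_{m+3}] ≃ k[y₀, …, y_{m+1}][Y₀, Y₁]` with `X₀ ↦ Y₀`, `X_{l+1} ↦ Y₁` (slices) and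
`X_{(l.succAbove j)+1} ↦ C yⱼ` (base), built from the bijection `Fin 2 ⊕ Fin (m+2) ≃ Fin (m+4)`, `inl ↦ (0, l+1)`, `inr j ↦ (l.succAbove j)+1`.
[folklore] -/
theorem exists_slicing (k : Type) [Field k] (m : ℕ) (l : Fin (m + 3)) :
    ∃ Ψ : MvPolynomial (Fin (m + 4)) k ≃+* MvPolynomial (Fin 2) (MvPolynomial (Fin (m + 2)) k),
      Ψ (X 0) = X 0 ∧ Ψ (X l.succ) = X 1 ∧ ∀ j : Fin (m + 2), Ψ (X (l.succAbove j).succ) = C (X j) := by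
  -- the index bijection
  let emb : Fin 2 ⊕ Fin (m + 2) → Fin (m + 4) := Sum.elim ![0, l.succ] fun j => (l.succAbove j).succ
  have hinj : Function.Injective emb := by
    rintro (a | a) (b | b) h
    · simp only [emb, Sum.elim_inl] at h
      fin_cases a <;> fin_cases b
      · rfl
      · exact absurd h (Fin.succ_ne_zero l).symm
      · exact absurd h (Fin.succ_ne_zero l)
      · rfl
    · simp only [emb, Sum.elim_inl, Sum.elim_inr] at h
      fin_cases a
      · exact absurd h (Fin.succ_ne_zero _).symm
      · exact absurd (Fin.succ_injective _ h).symm (Fin.succAbove_ne l b)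
    · simp only [emb, Sum.elim_inl, Sum.elim_inr] at h
      fin_cases b
      · exact absurd h (Fin.succ_ne_zero _)
      · exact absurd (Fin.succ_injective _ h) (Fin.succAbove_ne l a)
    · simp only [emb, Sum.elim_inr] at h
      rw [Fin.succAbove_right_injective (Fin.succ_injective _ h)]
  have hbij : Function.Bijective emb := by
    rw [Fintype.bijective_iff_injective_and_card]
    exact ⟨hinj, by simp only [Fintype.card_sum, Fintype.card_fin]; omega⟩
  let e : Fin 2 ⊕ Fin (m + 2) ≃ Fin (m + 4) := Equiv.ofBijective emb hbij
  have he0 : e.symm 0 = Sum.inl 0 := e.symm_apply_eq.mpr rfl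
  have he1 : e.symm l.succ = Sum.inl 1 := e.symm_apply_eq.mpr rfl
  have hej : ∀ j : Fin (m + 2), e.symm (l.succAbove j).succ = Sum.inr j := fun j => e.symm_apply_eq.mpr rfl
  refine ⟨((renameEquiv k e.symm).trans (sumAlgEquiv k (Fin 2) (Fin (m + 2)))).toRingEquiv, ?_, ?_, fun j => ?_⟩
  · show sumAlgEquiv k (Fin 2) (Fin (m + 2)) (rename _ (X 0)) = _
    rw [rename_X, he0]; exact sumAlgEquiv_X_inl _ _ _ _
  · show sumAlgEquiv k (Fin 2) (Fin (m + 2)) (rename _ (X l.succ)) = _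
    rw [rename_X, he1]; exact sumAlgEquiv_X_inl _ _ _ _
  · show sumAlgEquiv k (Fin 2) (Fin (m + 2)) (rename _ (X (l.succAbove j).succ)) = _
    rw [rename_X, hej]; exact sumAlgEquiv_X_inr _ _ _ _

/-- ★ **THE CHART CLAUSE on the exceptional divisor of the chart `X_{l+1}`.** `g = X₀² + X_{l+1}·h`, `h = 1 + Σ_j X_{(l.succAbove j)+1}³`; at a
maximal ideal `Q ∋ x̄_{l+1}` of `k[X]/(g)`: if `h ∉ Q` then `∂_{l+1} g = h ∉ Q` and the point is REGULAR (Jacobian, `ClauseOfPderivNotMem`); if `h ∈ Q`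
(a SINGULAR point: `g ∈ Q²`) the point is F-PURE by Fedder read through the slicing `exists_slicing`: `Ψ g = Y₀² + Y₁·C φ`, `φ = 1 + Σ yⱼ³`, the
`Y₁`-coefficient of `Ψ(g^{p−1}) = Ψ g` is `1·φ¹`, and the hypersurface `φ = 0` is SMOOTH (`∂φ/∂yⱼ = yⱼ²`; all `yⱼ ∈ 𝔭` would force `φ ≡ 1`)
— `FedderViaSlicing.clause_of_sliceCoeff`. (Stated with named `g`, `h` and their defining equations, so that callers may pass `rfl`.)
[cite: Fedder1983, Prop. 1.7 and Thm. 1.12; Hartshorne1977, I Thm. 5.1] -/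
theorem chart_succ_clause (k : Type) [Field k] [CharP k 2] (m : ℕ) (l : Fin (m + 3)) (h g : MvPolynomial (Fin (m + 4)) k)
    (hh : h = 1 + ∑ j : Fin (m + 2), (X (l.succAbove j).succ : MvPolynomial (Fin (m + 4)) k) ^ 3)
    (hg : g = X 0 ^ 2 + X l.succ * h)
    (Q : Ideal (MvPolynomial (Fin (m + 4)) k ⧸ Ideal.span {g})) [Q.IsMaximal]
    (hQ : Ideal.Quotient.mk (Ideal.span {g}) (X l.succ) ∈ Q) :
    ∀ d : ℕ, ringKrullDim (Localization.AtPrime Q) = d → ∀ s : Fin d → Localization.AtPrime Q,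
      (Ideal.span (Set.range s)).radical.IsMaximal →
        RingTheory.Sequence.IsWeaklyRegular (Localization.AtPrime Q) (List.ofFn s) ∧
        ∀ y : Localization.AtPrime Q, (∃ e : ℕ, y ^ 2 ^ e ∈ Ideal.span
          ((fun z : Localization.AtPrime Q => z ^ 2 ^ e) ''
            (Ideal.span (Set.range s) : Set (Localization.AtPrime Q)))) → y ∈ Ideal.span (Set.range s) := by
  haveI : Fact (Nat.Prime 2) := ⟨Nat.prime_two⟩
  have hP : (Q.comap (Ideal.Quotient.mk (Ideal.span {g}))).IsPrime := Ideal.comap_isPrime _ _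
  have hXl : (X l.succ : MvPolynomial (Fin (m + 4)) k) ∈ Q.comap (Ideal.Quotient.mk (Ideal.span {g})) := hQ
  -- Jacobian exit: `h ∉ Q`
  by_cases hhQ : h ∈ Q.comap (Ideal.Quotient.mk (Ideal.span {g})); swap
  · have hd : pderiv l.succ g = h := by rw [hg]; exact pderiv_succ_g k m l h hh
    exact ClauseOfPderivNotMem.stub_clauseOfPderivNotMem 2 k (m + 4) g Q l.succ (by rw [hd]; exact hhQ)
  -- the singular points: `h ∈ Q`; then `X₀ ∈ Q` as well
  have hgQ : g ∈ Q.comap (Ideal.Quotient.mk (Ideal.span {g})) := FermatCubicConeChar2.self_mem_comap g Q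
  have hX0 : (X 0 : MvPolynomial (Fin (m + 4)) k) ∈ Q.comap (Ideal.Quotient.mk (Ideal.span {g})) := by
    refine hP.mem_of_pow_mem 2 ?_
    have e : (X 0 : MvPolynomial (Fin (m + 4)) k) ^ 2 = g - X l.succ * h := by rw [hg]; ring
    rw [e]
    exact Ideal.sub_mem _ hgQ (Ideal.mul_mem_right _ _ hXl)
  have hg0 : g ≠ 0 := by
    intro h0
    have hne := g_succ_not_mem_span_X k m l
    rw [← hh, ← hg, h0] at hne
    exact hne (Ideal.zero_mem _)
  -- the slicing
  obtain ⟨Ψ, hΨ0, hΨ1, hΨj⟩ := exists_slicing k m l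
  have hy0 : Ψ.symm (X 0) = X 0 := Ψ.symm_apply_eq.mpr hΨ0.symm
  have hy1 : Ψ.symm (X 1) = X l.succ := Ψ.symm_apply_eq.mpr hΨ1.symm
  have hy : ∀ t : Fin 2, Ψ.symm (X t) ∈ Q.comap (Ideal.Quotient.mk (Ideal.span {g})) := by
    intro t
    fin_cases t
    · exact hy0 ▸ hX0
    · exact hy1 ▸ hXl
  -- the extracted coefficient: `Ψ g = Y₀² + Y₁ · C φ`, `φ = 1 + Σ yⱼ³`
  obtain ⟨φ, hφ⟩ : ∃ φ : MvPolynomial (Fin (m + 2)) k, φ = 1 + ∑ j : Fin (m + 2), X j ^ 3 := ⟨_, rfl⟩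
  have hΨh : Ψ h = C φ := by
    rw [hh, hφ, map_add, map_one, map_sum, map_add, map_one, map_sum]
    congr 1
    exact Finset.sum_congr rfl fun j _ => by rw [map_pow, hΨj, map_pow]
  have hΨg : Ψ g = X 0 ^ 2 + X 1 * C φ := by
    rw [hg, map_add, map_pow, hΨ0, map_mul, hΨ1, hΨh]
  have hcoeff : coeff (Finsupp.single (1 : Fin 2) 1) (Ψ (g ^ (2 - 1))) = 1 * φ ^ 1 := by
    have hne : (Finsupp.single (0 : Fin 2) 2 : Fin 2 →₀ ℕ) ≠ Finsupp.single 1 1 := by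
      intro h01
      have := Finsupp.ext_iff.mp h01 0
      simp at this
    classical
    rw [show (2 - 1 : ℕ) = 1 from rfl, pow_one, hΨg, coeff_add, X_pow_eq_monomial, coeff_monomial, if_neg hne, zero_add,
      mul_comm, C_mul_X_eq_monomial, coeff_monomial, if_pos rfl, one_mul, pow_one]
  have hdslice : ∀ t : Fin 2, (Finsupp.single (1 : Fin 2) 1 : Fin 2 →₀ ℕ) t < 2 := by
    intro t
    fin_cases t <;> simp
  -- the base hypersurface `φ = 0` is smooth: either `φ ∉ 𝔭` or some `∂φ/∂yⱼ = yⱼ² ∉ 𝔭`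
  have h𝔭 : ((Q.comap (Ideal.Quotient.mk (Ideal.span {g}))).comap (Ψ.symm.toRingHom.comp C)).IsPrime := Ideal.comap_isPrime _ _
  have hφalt : φ ∉ (Q.comap (Ideal.Quotient.mk (Ideal.span {g}))).comap (Ψ.symm.toRingHom.comp C) ∨
      ∃ i : Fin (m + 2), pderiv i φ ∉ (Q.comap (Ideal.Quotient.mk (Ideal.span {g}))).comap (Ψ.symm.toRingHom.comp C) := by
    by_cases hall : ∀ j : Fin (m + 2), (X j : MvPolynomial (Fin (m + 2)) k) ∈
        (Q.comap (Ideal.Quotient.mk (Ideal.span {g}))).comap (Ψ.symm.toRingHom.comp C)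
    · left
      intro hφmem
      have hsum : (∑ j : Fin (m + 2), (X j : MvPolynomial (Fin (m + 2)) k) ^ 3) ∈
          (Q.comap (Ideal.Quotient.mk (Ideal.span {g}))).comap (Ψ.symm.toRingHom.comp C) :=
        Ideal.sum_mem _ fun j _ => Ideal.pow_mem_of_mem _ (hall j) 3 (by norm_num)
      have h1 := Ideal.sub_mem _ hφmem hsum
      rw [hφ, add_sub_cancel_right] at h1
      exact h𝔭.ne_top ((Ideal.eq_top_iff_one _).mpr h1)
    · right
      push Not at hall
      obtain ⟨j, hj⟩ := hall
      refine ⟨j, ?_⟩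
      have hch : (3 : MvPolynomial (Fin (m + 2)) k) = 1 := (FermatCubicConeChar2.two_three k (n := m + 2)).2
      rw [hφ, map_add, pderiv_one, zero_add, FermatCubicConeChar2.pderiv_f k _ rfl j, hch, one_mul]
      exact fun h2 => hj (h𝔭.mem_of_pow_mem 2 h2)
  exact FedderViaSlicing.clause_of_sliceCoeff 2 k Ψ g hg0 Q hy _ hdslice 1 φ isUnit_one 1 (by norm_num) hcoeff hφalt

end Summit.ResolutionOfSingularities.ResolutionOfSingularities.Theorems.FInjectiveMacaulayfication.DoublePointFermatCubicCharts

end
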